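import Summits.Ventures.PercRepro.GenQFlatLatticeJ

/-!
# PercRepro — the flat-lattice counting rows, part K: the pencil lemma in its numerical form (night-4, gen 11)

From `pencil_card_le` (part J): the common flat `F` of the pencil has `f = |F ∩ G| ≤ FC[q−2]` (the bound `B₂` on the
flats of rank `q − 2`) and `f < s` (the trace of each hyperplane spans it, `F` does not), and the bound
`h_s · (s − f) ≤ n − f` only weakens as `f` grows; so with `f* = min(B₂, s − 1)`,

`h_s · (s − f*) ≤ n − f*`   (`pencil_hypTr_mul_le`, for `h_s ≥ 2` and `3s − 2n > FC[q−3]`)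

— the row (G-P) of the two-level profile LP exactly as the LP uses it (`h_s ≤ ⌊(n − f*)/(s − f*)⌋`, sheet §65 (b)).
Imports `GenQFlatLatticeJ`.
-/
namespace PercRepro.Night4

open Finset ThmH SixFour GenQ PerFlat Star

variable {α : Type*} [DecidableEq α] {M : Matroid α} [M.Finite]

/-- A flat of rank `q − 2` inside a rank-`(q − 1)` flat with an `s`-point spanning trace misses a point of the
trace: `|F ∩ G| < s` (`1 ≤ q`). -/
theorem card_inter_lt_of_subset_of_mem_flatsTr {G F H : Finset α} {q s : ℕ} (hq : 2 ≤ q)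
    (hF : F ∈ flatsQ M (q - 2)) (hH : H ∈ flatsTr M G (q - 1) s) (hFH : F ⊆ H) : (F ∩ G).card < s := by
  have hH1 := mem_flatsTr.1 hH
  have hsub : F ∩ G ⊆ H ∩ G := Finset.inter_subset_inter hFH (Finset.Subset.refl G)
  rcases (Finset.card_le_card hsub).lt_or_eq with hlt | heq
  · rw [hH1.2.1] at hlt; exact hlt
  · exfalso
    have heq' : F ∩ G = H ∩ G := Finset.eq_of_subset_of_card_le hsub heq.ge
    -- the trace of `H` would lie in `F`, of rank `q − 2 < q − 1`
    have h1 : M.eRk ((H ∩ G : Finset α) : Set α) ≤ M.eRk (F : Set α) := by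
      rw [← heq']
      exact M.eRk_mono (Finset.coe_subset.2 Finset.inter_subset_left)
    rw [hH1.2.2, (mem_flatsQ.1 hF).2.2] at h1
    have h2 : q - 1 ≤ q - 2 := by exact_mod_cast h1
    omega

/-- **(G-P), the numerical form**: `h_s · (s − f*) ≤ n − f*` with `f* = min(B₂, s − 1)`, for `h_s ≥ 2`,
`3s − 2n > B` (`B` bounds the flats of rank `≤ q − 3`, `B₂` those of rank `q − 2`). -/
theorem pencil_hypTr_mul_le {G : Finset α} {q s B B₂ : ℕ} (hq : 3 ≤ q)
    (hB : ∀ a ≤ q - 3, ∀ K ∈ flatsQ M a, K.card ≤ B) (hB₂ : ∀ K ∈ flatsQ M (q - 2), K.card ≤ B₂)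
    (hlarge : B < 3 * s - 2 * G.card) (hh : 2 ≤ hypTr M G (q - 1) s) :
    hypTr M G (q - 1) s * (s - min B₂ (s - 1)) ≤ G.card - min B₂ (s - 1) := by
  obtain ⟨F, hF, hFsub, hpen⟩ := pencil_card_le hq hB hlarge hh
  -- a trace to compare with
  have hpos : 0 < (flatsTr M G (q - 1) s).card := by unfold hypTr at hh; omega
  obtain ⟨H, hH⟩ := Finset.card_pos.1 hpos
  have hfs : (F ∩ G).card < s := card_inter_lt_of_subset_of_mem_flatsTr (by omega) hF hH (hFsub H hH)
  have hfB : (F ∩ G).card ≤ B₂ := (Finset.card_le_card Finset.inter_subset_left).trans (hB₂ F hF)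
  have hsn : s ≤ G.card := by
    rw [← (mem_flatsTr.1 hH).2.1]; exact Finset.card_le_card Finset.inter_subset_right
  -- monotonicity in `f`: `h·(s − f*) ≤ h·(s − f) − h·(f* − f) ≤ n − f − (f* − f) = n − f*`
  set f := (F ∩ G).card with hfdef
  set fs := min B₂ (s - 1) with hfsdef
  have hff : f ≤ fs := le_min hfB (by omega)
  have hfss : fs ≤ s - 1 := min_le_right _ _
  have e1 : s - f = (s - fs) + (fs - f) := by omega
  have e2 : G.card - f = (G.card - fs) + (fs - f) := by omega
  rw [e1, Nat.mul_add, e2] at hpen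
  have e3 : fs - f ≤ hypTr M G (q - 1) s * (fs - f) := Nat.le_mul_of_pos_left _ (by omega)
  omega

end PercRepro.Night4
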